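import Summits.Ventures.YMGap.RobustBall.StarWindowZdWRowsSU2
import Summits.Ventures.YMGap.RobustBall.MassiveOnBallZdW
import Summits.Ventures.YMGap.RobustBall.PeriodisedDLRSummable
import HarnessLib

/-!
# Venture YMGap, track ROBUST-BALL (Y2) — THE `SU(2)` TIER-2 `ℤ⁴` TABLE, CELL BY CELL: EVERY DLR STATE IS MASSIVE, and so is
# every van Hove limit state — every weight `κ ≥ 1/100`, up to `β_W = 1/3`

HONEST FRAMING. WHAT THIS IS: a venture file (cell `pub-ymgap`, track Y2 ROBUST-BALL, seat ds-2): one-line consequences of the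
window cells `su2_starWindowBoundZdW_star_<cell>` (`StarWindowZdWRowsSU2.lean`) through the massive bridge
(`massive_of_starWindowBoundZdW`, `MassiveOnBallZdW.lean` ← `StarDoorZdWMassive.lean`). For each cell
`(β_W, ε)` ∈ {(1/10,.173) (1/8,.148) (1/6,.111) (1/5,.086) (1/4,.054) (3/10,.027) (1/3,.011)} and EVERY member `W` of the ball
`MemBallZdW (1/100) (2ε) ε` (gauge-invariant summable perturbations of `SU(2)` Wilson on `ℤ⁴` of ARBITRARY range; tree coupling `β_W/2`):
* `su2_massive_onBallZdW_star_<cell>` (+ `_allWeights`: every `κ ≥ 1/100`) — DLR states exist and EVERY DLR state is an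
  Osterwalder–Seiler MASSIVE STATE (`IsMassiveState`: truncated correlations of ALL bounded measurable local observables decay
  exponentially) with exponentially decaying plaquette–plaquette correlation function — today's tier-2 massive rows
  (`MassGapOnBallZdSMassive.lean`, single-link pair) stop at `β_W ≤ 1/6`;
* `su2_vanHove_massive_star_<cell>` — every infinite-volume limit state of the member's periodised torus states is massive
  (it IS the one DLR state: `oneState_onBallZdW` + the mass-gap cell);
* `su2_massive_onBallZdW_star_upTo_oneThird` (all `0 ≤ β_W ≤ 1/3` on the `1/3` ball) and the Wilson point
  `su2_wilson_massive_upTo_oneThird`.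
WHAT THIS IS NOT: strong-coupling LATTICE statements; the rate is the door rate (an artefact); nothing about the continuum,
a transfer-matrix gap or the Millennium problem. References: K. Osterwalder, E. Seiler, Ann. Phys. 110 (1978) §4.
-/

noncomputable section

open MeasureTheory Function Finset Real
open scoped NNReal
open Literature.Probability.LatticeModels
open Literature.MathematicalPhysics.QuantumLattice hiding torusNorm
open Literature.MathematicalPhysics.QuantumFieldTheory hiding ZdEdge
open Literature.Barriers.QuantumFields (IsMassiveState)
open Summit.Ventures.YMGap.DSWindowZd
open Summit.Ventures.YMGap.StarResolventDim (gaugeR doorPoly Delta)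

namespace Summit.Ventures.YMGap.RobustBall

/-! ### Cell `(β_W, ε) = (1 / 10, 0.173)` -/

/-- **MASSIVE**: for every member of `MemBallZdW (1/100) (173 / 500) (173 / 1000)`, DLR states of `(1 / 20)·S_W + W` exist and EVERY DLR state is an
Osterwalder–Seiler massive state with exponentially decaying plaquette–plaquette correlations; HYPOTHESIS-FREE. [folklore] -/
theorem su2_massive_onBallZdW_star_oneTenth :
    ∀ W : Potential (ZdEdge 4) (SUN 2), MemBallZdW (1 / 100) (173 / 500) (173 / 1000) W →
      (perturbedGibbsMeasuresS (d := 4) (fundamentalRep (Fin 2)) (1 / 20) W).Nonempty ∧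
        ∀ μ ∈ perturbedGibbsMeasuresS (d := 4) (fundamentalRep (Fin 2)) (1 / 20) W,
          IsMassiveState μ ∧ HasExponentialDecay (plaquetteCorrFn (fundamentalRep (Fin 2)) μ) := by
  intro W hW
  have e : ((2 : ℕ) : ℝ) * ((1 / 10 : ℝ) / 4) = 1 / 20 := by norm_num
  have h := massive_of_starWindowBoundZdW (N := 2) (by norm_num) hW (t := 1 / 1000000) (by norm_num) (by norm_num)
    (by norm_num) (by norm_num) starReach_nonneg (fun s x hx y => norm_sub_le_starReach s hx y)
    (su2_starWindowBoundZdW_star_oneTenth W hW)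
  rwa [e] at h

/-- The massive cell at EVERY weight `κ ≥ 1/100`. [folklore] -/
theorem su2_massive_onBallZdW_star_oneTenth_allWeights {κ : ℝ} (hκ : 1 / 100 ≤ κ) :
    ∀ W : Potential (ZdEdge 4) (SUN 2), MemBallZdW κ (173 / 500) (173 / 1000) W →
      (perturbedGibbsMeasuresS (d := 4) (fundamentalRep (Fin 2)) (1 / 20) W).Nonempty ∧
        ∀ μ ∈ perturbedGibbsMeasuresS (d := 4) (fundamentalRep (Fin 2)) (1 / 20) W,
          IsMassiveState μ ∧ HasExponentialDecay (plaquetteCorrFn (fundamentalRep (Fin 2)) μ) := fun W hW =>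
  su2_massive_onBallZdW_star_oneTenth W (hW.of_weight_le hκ)

/-- **EVERY VAN HOVE LIMIT STATE IS MASSIVE** (`β_W = 1 / 10`): every infinite-volume limit state of the member's periodised torus
states is its one DLR state (`oneState_onBallZdW` + `su2_massGapOnBallZdW_star_oneTenth`), hence massive. [folklore] -/
theorem su2_vanHove_massive_star_oneTenth :
    ∀ (W : Potential (ZdEdge 4) (SUN 2)) (hW : MemBallZdW (1 / 100) (173 / 500) (173 / 1000) W),
      ∀ μ ∈ perturbedLimitPoints (1 / 20) (periodisedFamilyS W hW.dependsOn hW.gaugeInvariant hW.continuous),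
        IsMassiveState μ ∧ HasExponentialDecay (plaquetteCorrFn (fundamentalRep (Fin 2)) μ) := by
  intro W hW μ hμ
  obtain ⟨⟨ν, hν⟩, hall⟩ := su2_massive_onBallZdW_star_oneTenth W hW
  have e : ((2 : ℕ) : ℝ) * (1 / 40 : ℝ) = 1 / 20 := by norm_num
  rw [← e] at hμ hν
  have hμν : μ = ν := oneState_onBallZdW su2_massGapOnBallZdW_star_oneTenth hW hμ hν
  rw [e] at hν
  exact hall μ (hμν ▸ hν)

/-! ### Cell `(β_W, ε) = (1 / 8, 0.148)` -/

/-- **MASSIVE**: for every member of `MemBallZdW (1/100) (37 / 125) (37 / 250)`, DLR states of `(1 / 16)·S_W + W` exist and EVERY DLR state is an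
Osterwalder–Seiler massive state with exponentially decaying plaquette–plaquette correlations; HYPOTHESIS-FREE. [folklore] -/
theorem su2_massive_onBallZdW_star_oneEighth :
    ∀ W : Potential (ZdEdge 4) (SUN 2), MemBallZdW (1 / 100) (37 / 125) (37 / 250) W →
      (perturbedGibbsMeasuresS (d := 4) (fundamentalRep (Fin 2)) (1 / 16) W).Nonempty ∧
        ∀ μ ∈ perturbedGibbsMeasuresS (d := 4) (fundamentalRep (Fin 2)) (1 / 16) W,
          IsMassiveState μ ∧ HasExponentialDecay (plaquetteCorrFn (fundamentalRep (Fin 2)) μ) := by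
  intro W hW
  have e : ((2 : ℕ) : ℝ) * ((1 / 8 : ℝ) / 4) = 1 / 16 := by norm_num
  have h := massive_of_starWindowBoundZdW (N := 2) (by norm_num) hW (t := 1 / 1000000) (by norm_num) (by norm_num)
    (by norm_num) (by norm_num) starReach_nonneg (fun s x hx y => norm_sub_le_starReach s hx y)
    (su2_starWindowBoundZdW_star_oneEighth W hW)
  rwa [e] at h

/-- The massive cell at EVERY weight `κ ≥ 1/100`. [folklore] -/
theorem su2_massive_onBallZdW_star_oneEighth_allWeights {κ : ℝ} (hκ : 1 / 100 ≤ κ) :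
    ∀ W : Potential (ZdEdge 4) (SUN 2), MemBallZdW κ (37 / 125) (37 / 250) W →
      (perturbedGibbsMeasuresS (d := 4) (fundamentalRep (Fin 2)) (1 / 16) W).Nonempty ∧
        ∀ μ ∈ perturbedGibbsMeasuresS (d := 4) (fundamentalRep (Fin 2)) (1 / 16) W,
          IsMassiveState μ ∧ HasExponentialDecay (plaquetteCorrFn (fundamentalRep (Fin 2)) μ) := fun W hW =>
  su2_massive_onBallZdW_star_oneEighth W (hW.of_weight_le hκ)

/-- **EVERY VAN HOVE LIMIT STATE IS MASSIVE** (`β_W = 1 / 8`): every infinite-volume limit state of the member's periodised torus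
states is its one DLR state (`oneState_onBallZdW` + `su2_massGapOnBallZdW_star_oneEighth`), hence massive. [folklore] -/
theorem su2_vanHove_massive_star_oneEighth :
    ∀ (W : Potential (ZdEdge 4) (SUN 2)) (hW : MemBallZdW (1 / 100) (37 / 125) (37 / 250) W),
      ∀ μ ∈ perturbedLimitPoints (1 / 16) (periodisedFamilyS W hW.dependsOn hW.gaugeInvariant hW.continuous),
        IsMassiveState μ ∧ HasExponentialDecay (plaquetteCorrFn (fundamentalRep (Fin 2)) μ) := by
  intro W hW μ hμ
  obtain ⟨⟨ν, hν⟩, hall⟩ := su2_massive_onBallZdW_star_oneEighth W hW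
  have e : ((2 : ℕ) : ℝ) * (1 / 32 : ℝ) = 1 / 16 := by norm_num
  rw [← e] at hμ hν
  have hμν : μ = ν := oneState_onBallZdW su2_massGapOnBallZdW_star_oneEighth hW hμ hν
  rw [e] at hν
  exact hall μ (hμν ▸ hν)

/-! ### Cell `(β_W, ε) = (1 / 6, 0.111)` -/

/-- **MASSIVE**: for every member of `MemBallZdW (1/100) (111 / 500) (111 / 1000)`, DLR states of `(1 / 12)·S_W + W` exist and EVERY DLR state is an
Osterwalder–Seiler massive state with exponentially decaying plaquette–plaquette correlations; HYPOTHESIS-FREE. [folklore] -/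
theorem su2_massive_onBallZdW_star_oneSixth :
    ∀ W : Potential (ZdEdge 4) (SUN 2), MemBallZdW (1 / 100) (111 / 500) (111 / 1000) W →
      (perturbedGibbsMeasuresS (d := 4) (fundamentalRep (Fin 2)) (1 / 12) W).Nonempty ∧
        ∀ μ ∈ perturbedGibbsMeasuresS (d := 4) (fundamentalRep (Fin 2)) (1 / 12) W,
          IsMassiveState μ ∧ HasExponentialDecay (plaquetteCorrFn (fundamentalRep (Fin 2)) μ) := by
  intro W hW
  have e : ((2 : ℕ) : ℝ) * ((1 / 6 : ℝ) / 4) = 1 / 12 := by norm_num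
  have h := massive_of_starWindowBoundZdW (N := 2) (by norm_num) hW (t := 1 / 1000000) (by norm_num) (by norm_num)
    (by norm_num) (by norm_num) starReach_nonneg (fun s x hx y => norm_sub_le_starReach s hx y)
    (su2_starWindowBoundZdW_star_oneSixth W hW)
  rwa [e] at h

/-- The massive cell at EVERY weight `κ ≥ 1/100`. [folklore] -/
theorem su2_massive_onBallZdW_star_oneSixth_allWeights {κ : ℝ} (hκ : 1 / 100 ≤ κ) :
    ∀ W : Potential (ZdEdge 4) (SUN 2), MemBallZdW κ (111 / 500) (111 / 1000) W →
      (perturbedGibbsMeasuresS (d := 4) (fundamentalRep (Fin 2)) (1 / 12) W).Nonempty ∧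
        ∀ μ ∈ perturbedGibbsMeasuresS (d := 4) (fundamentalRep (Fin 2)) (1 / 12) W,
          IsMassiveState μ ∧ HasExponentialDecay (plaquetteCorrFn (fundamentalRep (Fin 2)) μ) := fun W hW =>
  su2_massive_onBallZdW_star_oneSixth W (hW.of_weight_le hκ)

/-- **EVERY VAN HOVE LIMIT STATE IS MASSIVE** (`β_W = 1 / 6`): every infinite-volume limit state of the member's periodised torus
states is its one DLR state (`oneState_onBallZdW` + `su2_massGapOnBallZdW_star_oneSixth`), hence massive. [folklore] -/
theorem su2_vanHove_massive_star_oneSixth :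
    ∀ (W : Potential (ZdEdge 4) (SUN 2)) (hW : MemBallZdW (1 / 100) (111 / 500) (111 / 1000) W),
      ∀ μ ∈ perturbedLimitPoints (1 / 12) (periodisedFamilyS W hW.dependsOn hW.gaugeInvariant hW.continuous),
        IsMassiveState μ ∧ HasExponentialDecay (plaquetteCorrFn (fundamentalRep (Fin 2)) μ) := by
  intro W hW μ hμ
  obtain ⟨⟨ν, hν⟩, hall⟩ := su2_massive_onBallZdW_star_oneSixth W hW
  have e : ((2 : ℕ) : ℝ) * (1 / 24 : ℝ) = 1 / 12 := by norm_num
  rw [← e] at hμ hν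
  have hμν : μ = ν := oneState_onBallZdW su2_massGapOnBallZdW_star_oneSixth hW hμ hν
  rw [e] at hν
  exact hall μ (hμν ▸ hν)

/-! ### Cell `(β_W, ε) = (1 / 5, 0.086)` -/

/-- **MASSIVE**: for every member of `MemBallZdW (1/100) (43 / 250) (43 / 500)`, DLR states of `(1 / 10)·S_W + W` exist and EVERY DLR state is an
Osterwalder–Seiler massive state with exponentially decaying plaquette–plaquette correlations; HYPOTHESIS-FREE. [folklore] -/
theorem su2_massive_onBallZdW_star_oneFifth :
    ∀ W : Potential (ZdEdge 4) (SUN 2), MemBallZdW (1 / 100) (43 / 250) (43 / 500) W →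
      (perturbedGibbsMeasuresS (d := 4) (fundamentalRep (Fin 2)) (1 / 10) W).Nonempty ∧
        ∀ μ ∈ perturbedGibbsMeasuresS (d := 4) (fundamentalRep (Fin 2)) (1 / 10) W,
          IsMassiveState μ ∧ HasExponentialDecay (plaquetteCorrFn (fundamentalRep (Fin 2)) μ) := by
  intro W hW
  have e : ((2 : ℕ) : ℝ) * ((1 / 5 : ℝ) / 4) = 1 / 10 := by norm_num
  have h := massive_of_starWindowBoundZdW (N := 2) (by norm_num) hW (t := 1 / 1000000) (by norm_num) (by norm_num)
    (by norm_num) (by norm_num) starReach_nonneg (fun s x hx y => norm_sub_le_starReach s hx y)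
    (su2_starWindowBoundZdW_star_oneFifth W hW)
  rwa [e] at h

/-- The massive cell at EVERY weight `κ ≥ 1/100`. [folklore] -/
theorem su2_massive_onBallZdW_star_oneFifth_allWeights {κ : ℝ} (hκ : 1 / 100 ≤ κ) :
    ∀ W : Potential (ZdEdge 4) (SUN 2), MemBallZdW κ (43 / 250) (43 / 500) W →
      (perturbedGibbsMeasuresS (d := 4) (fundamentalRep (Fin 2)) (1 / 10) W).Nonempty ∧
        ∀ μ ∈ perturbedGibbsMeasuresS (d := 4) (fundamentalRep (Fin 2)) (1 / 10) W,
          IsMassiveState μ ∧ HasExponentialDecay (plaquetteCorrFn (fundamentalRep (Fin 2)) μ) := fun W hW =>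
  su2_massive_onBallZdW_star_oneFifth W (hW.of_weight_le hκ)

/-- **EVERY VAN HOVE LIMIT STATE IS MASSIVE** (`β_W = 1 / 5`): every infinite-volume limit state of the member's periodised torus
states is its one DLR state (`oneState_onBallZdW` + `su2_massGapOnBallZdW_star_oneFifth`), hence massive. [folklore] -/
theorem su2_vanHove_massive_star_oneFifth :
    ∀ (W : Potential (ZdEdge 4) (SUN 2)) (hW : MemBallZdW (1 / 100) (43 / 250) (43 / 500) W),
      ∀ μ ∈ perturbedLimitPoints (1 / 10) (periodisedFamilyS W hW.dependsOn hW.gaugeInvariant hW.continuous),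
        IsMassiveState μ ∧ HasExponentialDecay (plaquetteCorrFn (fundamentalRep (Fin 2)) μ) := by
  intro W hW μ hμ
  obtain ⟨⟨ν, hν⟩, hall⟩ := su2_massive_onBallZdW_star_oneFifth W hW
  have e : ((2 : ℕ) : ℝ) * (1 / 20 : ℝ) = 1 / 10 := by norm_num
  rw [← e] at hμ hν
  have hμν : μ = ν := oneState_onBallZdW su2_massGapOnBallZdW_star_oneFifth hW hμ hν
  rw [e] at hν
  exact hall μ (hμν ▸ hν)

/-! ### Cell `(β_W, ε) = (1 / 4, 0.054)` -/

/-- **MASSIVE**: for every member of `MemBallZdW (1/100) (27 / 250) (27 / 500)`, DLR states of `(1 / 8)·S_W + W` exist and EVERY DLR state is an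
Osterwalder–Seiler massive state with exponentially decaying plaquette–plaquette correlations; HYPOTHESIS-FREE. [folklore] -/
theorem su2_massive_onBallZdW_star_oneQuarter :
    ∀ W : Potential (ZdEdge 4) (SUN 2), MemBallZdW (1 / 100) (27 / 250) (27 / 500) W →
      (perturbedGibbsMeasuresS (d := 4) (fundamentalRep (Fin 2)) (1 / 8) W).Nonempty ∧
        ∀ μ ∈ perturbedGibbsMeasuresS (d := 4) (fundamentalRep (Fin 2)) (1 / 8) W,
          IsMassiveState μ ∧ HasExponentialDecay (plaquetteCorrFn (fundamentalRep (Fin 2)) μ) := by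
  intro W hW
  have e : ((2 : ℕ) : ℝ) * ((1 / 4 : ℝ) / 4) = 1 / 8 := by norm_num
  have h := massive_of_starWindowBoundZdW (N := 2) (by norm_num) hW (t := 1 / 1000000) (by norm_num) (by norm_num)
    (by norm_num) (by norm_num) starReach_nonneg (fun s x hx y => norm_sub_le_starReach s hx y)
    (su2_starWindowBoundZdW_star_oneQuarter W hW)
  rwa [e] at h

/-- The massive cell at EVERY weight `κ ≥ 1/100`. [folklore] -/
theorem su2_massive_onBallZdW_star_oneQuarter_allWeights {κ : ℝ} (hκ : 1 / 100 ≤ κ) :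
    ∀ W : Potential (ZdEdge 4) (SUN 2), MemBallZdW κ (27 / 250) (27 / 500) W →
      (perturbedGibbsMeasuresS (d := 4) (fundamentalRep (Fin 2)) (1 / 8) W).Nonempty ∧
        ∀ μ ∈ perturbedGibbsMeasuresS (d := 4) (fundamentalRep (Fin 2)) (1 / 8) W,
          IsMassiveState μ ∧ HasExponentialDecay (plaquetteCorrFn (fundamentalRep (Fin 2)) μ) := fun W hW =>
  su2_massive_onBallZdW_star_oneQuarter W (hW.of_weight_le hκ)

/-- **EVERY VAN HOVE LIMIT STATE IS MASSIVE** (`β_W = 1 / 4`): every infinite-volume limit state of the member's periodised torus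
states is its one DLR state (`oneState_onBallZdW` + `su2_massGapOnBallZdW_star_oneQuarter`), hence massive. [folklore] -/
theorem su2_vanHove_massive_star_oneQuarter :
    ∀ (W : Potential (ZdEdge 4) (SUN 2)) (hW : MemBallZdW (1 / 100) (27 / 250) (27 / 500) W),
      ∀ μ ∈ perturbedLimitPoints (1 / 8) (periodisedFamilyS W hW.dependsOn hW.gaugeInvariant hW.continuous),
        IsMassiveState μ ∧ HasExponentialDecay (plaquetteCorrFn (fundamentalRep (Fin 2)) μ) := by
  intro W hW μ hμ
  obtain ⟨⟨ν, hν⟩, hall⟩ := su2_massive_onBallZdW_star_oneQuarter W hW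
  have e : ((2 : ℕ) : ℝ) * (1 / 16 : ℝ) = 1 / 8 := by norm_num
  rw [← e] at hμ hν
  have hμν : μ = ν := oneState_onBallZdW su2_massGapOnBallZdW_star_oneQuarter hW hμ hν
  rw [e] at hν
  exact hall μ (hμν ▸ hν)

/-! ### Cell `(β_W, ε) = (3 / 10, 0.027)` -/

/-- **MASSIVE**: for every member of `MemBallZdW (1/100) (27 / 500) (27 / 1000)`, DLR states of `(3 / 20)·S_W + W` exist and EVERY DLR state is an
Osterwalder–Seiler massive state with exponentially decaying plaquette–plaquette correlations; HYPOTHESIS-FREE. [folklore] -/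
theorem su2_massive_onBallZdW_star_threeTenths :
    ∀ W : Potential (ZdEdge 4) (SUN 2), MemBallZdW (1 / 100) (27 / 500) (27 / 1000) W →
      (perturbedGibbsMeasuresS (d := 4) (fundamentalRep (Fin 2)) (3 / 20) W).Nonempty ∧
        ∀ μ ∈ perturbedGibbsMeasuresS (d := 4) (fundamentalRep (Fin 2)) (3 / 20) W,
          IsMassiveState μ ∧ HasExponentialDecay (plaquetteCorrFn (fundamentalRep (Fin 2)) μ) := by
  intro W hW
  have e : ((2 : ℕ) : ℝ) * ((3 / 10 : ℝ) / 4) = 3 / 20 := by norm_num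
  have h := massive_of_starWindowBoundZdW (N := 2) (by norm_num) hW (t := 1 / 1000000) (by norm_num) (by norm_num)
    (by norm_num) (by norm_num) starReach_nonneg (fun s x hx y => norm_sub_le_starReach s hx y)
    (su2_starWindowBoundZdW_star_threeTenths W hW)
  rwa [e] at h

/-- The massive cell at EVERY weight `κ ≥ 1/100`. [folklore] -/
theorem su2_massive_onBallZdW_star_threeTenths_allWeights {κ : ℝ} (hκ : 1 / 100 ≤ κ) :
    ∀ W : Potential (ZdEdge 4) (SUN 2), MemBallZdW κ (27 / 500) (27 / 1000) W →
      (perturbedGibbsMeasuresS (d := 4) (fundamentalRep (Fin 2)) (3 / 20) W).Nonempty ∧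
        ∀ μ ∈ perturbedGibbsMeasuresS (d := 4) (fundamentalRep (Fin 2)) (3 / 20) W,
          IsMassiveState μ ∧ HasExponentialDecay (plaquetteCorrFn (fundamentalRep (Fin 2)) μ) := fun W hW =>
  su2_massive_onBallZdW_star_threeTenths W (hW.of_weight_le hκ)

/-- **EVERY VAN HOVE LIMIT STATE IS MASSIVE** (`β_W = 3 / 10`): every infinite-volume limit state of the member's periodised torus
states is its one DLR state (`oneState_onBallZdW` + `su2_massGapOnBallZdW_star_threeTenths`), hence massive. [folklore] -/
theorem su2_vanHove_massive_star_threeTenths :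
    ∀ (W : Potential (ZdEdge 4) (SUN 2)) (hW : MemBallZdW (1 / 100) (27 / 500) (27 / 1000) W),
      ∀ μ ∈ perturbedLimitPoints (3 / 20) (periodisedFamilyS W hW.dependsOn hW.gaugeInvariant hW.continuous),
        IsMassiveState μ ∧ HasExponentialDecay (plaquetteCorrFn (fundamentalRep (Fin 2)) μ) := by
  intro W hW μ hμ
  obtain ⟨⟨ν, hν⟩, hall⟩ := su2_massive_onBallZdW_star_threeTenths W hW
  have e : ((2 : ℕ) : ℝ) * (3 / 40 : ℝ) = 3 / 20 := by norm_num
  rw [← e] at hμ hν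
  have hμν : μ = ν := oneState_onBallZdW su2_massGapOnBallZdW_star_threeTenths hW hμ hν
  rw [e] at hν
  exact hall μ (hμν ▸ hν)

/-! ### Cell `(β_W, ε) = (1 / 3, 0.011)` -/

/-- **MASSIVE**: for every member of `MemBallZdW (1/100) (11 / 500) (11 / 1000)`, DLR states of `(1 / 6)·S_W + W` exist and EVERY DLR state is an
Osterwalder–Seiler massive state with exponentially decaying plaquette–plaquette correlations; HYPOTHESIS-FREE. [folklore] -/
theorem su2_massive_onBallZdW_star_oneThird :
    ∀ W : Potential (ZdEdge 4) (SUN 2), MemBallZdW (1 / 100) (11 / 500) (11 / 1000) W →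
      (perturbedGibbsMeasuresS (d := 4) (fundamentalRep (Fin 2)) (1 / 6) W).Nonempty ∧
        ∀ μ ∈ perturbedGibbsMeasuresS (d := 4) (fundamentalRep (Fin 2)) (1 / 6) W,
          IsMassiveState μ ∧ HasExponentialDecay (plaquetteCorrFn (fundamentalRep (Fin 2)) μ) := by
  intro W hW
  have e : ((2 : ℕ) : ℝ) * ((1 / 3 : ℝ) / 4) = 1 / 6 := by norm_num
  have h := massive_of_starWindowBoundZdW (N := 2) (by norm_num) hW (t := 1 / 1000000) (by norm_num) (by norm_num)
    (by norm_num) (by norm_num) starReach_nonneg (fun s x hx y => norm_sub_le_starReach s hx y)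
    (su2_starWindowBoundZdW_star_oneThird W hW)
  rwa [e] at h

/-- The massive cell at EVERY weight `κ ≥ 1/100`. [folklore] -/
theorem su2_massive_onBallZdW_star_oneThird_allWeights {κ : ℝ} (hκ : 1 / 100 ≤ κ) :
    ∀ W : Potential (ZdEdge 4) (SUN 2), MemBallZdW κ (11 / 500) (11 / 1000) W →
      (perturbedGibbsMeasuresS (d := 4) (fundamentalRep (Fin 2)) (1 / 6) W).Nonempty ∧
        ∀ μ ∈ perturbedGibbsMeasuresS (d := 4) (fundamentalRep (Fin 2)) (1 / 6) W,
          IsMassiveState μ ∧ HasExponentialDecay (plaquetteCorrFn (fundamentalRep (Fin 2)) μ) := fun W hW =>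
  su2_massive_onBallZdW_star_oneThird W (hW.of_weight_le hκ)

/-- **EVERY VAN HOVE LIMIT STATE IS MASSIVE** (`β_W = 1 / 3`): every infinite-volume limit state of the member's periodised torus
states is its one DLR state (`oneState_onBallZdW` + `su2_massGapOnBallZdW_star_oneThird`), hence massive. [folklore] -/
theorem su2_vanHove_massive_star_oneThird :
    ∀ (W : Potential (ZdEdge 4) (SUN 2)) (hW : MemBallZdW (1 / 100) (11 / 500) (11 / 1000) W),
      ∀ μ ∈ perturbedLimitPoints (1 / 6) (periodisedFamilyS W hW.dependsOn hW.gaugeInvariant hW.continuous),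
        IsMassiveState μ ∧ HasExponentialDecay (plaquetteCorrFn (fundamentalRep (Fin 2)) μ) := by
  intro W hW μ hμ
  obtain ⟨⟨ν, hν⟩, hall⟩ := su2_massive_onBallZdW_star_oneThird W hW
  have e : ((2 : ℕ) : ℝ) * (1 / 12 : ℝ) = 1 / 6 := by norm_num
  rw [← e] at hμ hν
  have hμν : μ = ν := oneState_onBallZdW su2_massGapOnBallZdW_star_oneThird hW hμ hν
  rw [e] at hν
  exact hall μ (hμν ▸ hν)

/-! ### Up-to form and the Wilson point -/

/-- **ALL `0 ≤ β_W ≤ 1 / 3` ON ONE TIER-2 BALL, MASSIVE FORM** (`d = 4`): for every `β_W ∈ [0, 1/3]` and every member of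
`MemBallZdW (1/100) (11 / 500) (11 / 1000)`, DLR states of `(β_W/2)·S_W + W` exist and every DLR state is massive — the `1 / 3`
window certificate is monotone in `β_W` (only `hc` sees `β_W`). [folklore] -/
theorem su2_massive_onBallZdW_star_upTo_oneThird {βW : ℝ} (h0 : 0 ≤ βW) (h : βW ≤ 1 / 3) :
    ∀ W : Potential (ZdEdge 4) (SUN 2), MemBallZdW (1 / 100) (11 / 500) (11 / 1000) W →
      (perturbedGibbsMeasuresS (d := 4) (fundamentalRep (Fin 2)) (βW / 2) W).Nonempty ∧
        ∀ μ ∈ perturbedGibbsMeasuresS (d := 4) (fundamentalRep (Fin 2)) (βW / 2) W,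
          IsMassiveState μ ∧ HasExponentialDecay (plaquetteCorrFn (fundamentalRep (Fin 2)) μ) := by
  intro W hW
  have e : ((2 : ℕ) : ℝ) * (βW / 4) = βW / 2 := by push_cast; ring
  rw [← e]
  refine massive_of_starWindowBoundZdW (N := 2) (by norm_num) hW (t := 1 / 1000000) (ρ := 999 / 1000) (by norm_num)
    (by norm_num) (by norm_num) (by norm_num) starReach_nonneg (fun s x hx y => norm_sub_le_starReach s hx y) ?_
  refine su2_starWindowBoundZdW_star_gen 20 1000 (by norm_num) (κ := 1 / 100) (t := 1 / 1000000) (τ := 1 / 2500)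
    (ε₀ := 11 / 500) (ε₁ := 11 / 1000) (c := 43919 / 500000) (lam := 15557 / 1000000) (E := 255561 / 250000) (S := 1.41422) (ρ' := 999 / 1000)
    (E2b := 1000801 / 1000000) (Gb := 20025 / 10000) (Ab := 10021 / 10000) (Fb := 1 / 22026)
    (F3b := (1000003 / 1000000) * ((1 / 22026) * (10011 / 10000)))
    (by norm_num) (by norm_num) (by norm_num) h0 (h.trans (by norm_num)) (by norm_num) exp_le_11_500_cstar3 sqrt_two_le ?_ (by norm_num)
    (by norm_num) (by unfold doorPoly; norm_num) exp_neg_k100_D1000_le (by norm_num)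
    exp_tau_w4.1 exp_tau_w4.2 exp_le_A1_k100 exp_far_k100
    (by unfold gaugeR Delta; norm_num) W hW
  calc (255561 / 250000 : ℝ) * (1 + 2 * 1.41422 * (11 / 1000)) * (βW / 4)
      ≤ 255561 / 250000 * (1 + 2 * 1.41422 * (11 / 1000)) * ((1 / 3) / 4) := by gcongr
    _ ≤ 43919 / 500000 := by norm_num

/-- ★ **The Wilson point as a corollary**: for every `0 ≤ β_W ≤ 1/3`, EVERY DLR state of `SU(2)` lattice Yang–Mills on `ℤ⁴`
with Wilson's action at tree coupling `β_W/2` (read through rb-p1's summable specification `perturbedYMS … 0`, the zero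
member of the tier-2 ball) is MASSIVE with exponentially decaying plaquette–plaquette correlations. [folklore] -/
theorem su2_wilson_massive_upTo_oneThird {βW : ℝ} (h0 : 0 ≤ βW) (h : βW ≤ 1 / 3) :
    ∀ μ ∈ perturbedGibbsMeasuresS (d := 4) (fundamentalRep (Fin 2)) (βW / 2) (0 : Potential (ZdEdge 4) (SUN 2)),
      IsMassiveState μ ∧ HasExponentialDecay (plaquetteCorrFn (fundamentalRep (Fin 2)) μ) :=
  (su2_massive_onBallZdW_star_upTo_oneThird h0 h 0 (memBallZdW_zero (by norm_num) (by norm_num))).2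

end Summit.Ventures.YMGap.RobustBall

end
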